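import Literature.Analysis.Complex.LaplaceHalfLineInversion
import HarnessLib

/-!
# The resolvent of an exponentially decaying renewal kernel, I: the symbol `E = 1 − 𝓛k`, the transformed resolvent
# equation `𝓛r·E = 𝓛k`, and decay / holomorphy / line-integrability of `Φ = (𝓛k)²/E`

Topic `Literature/Analysis/Convolution` (Volterra / renewal equations; next to `LaplaceTransformConvolution.lean`,
`OneSidedConvolution*.lean`). Everything here is PROVED. Part II (`RenewalResolventPole.lean`) proves the theorem; this file
holds the hypothesis structure and Steps 1–3.

SETTING (`RenewalPoleData`). `k : [0,∞) → ℂ` is `C¹` with `‖k‖, ‖k′‖ ≤ K e^{−μt}` (`μ > 0`); `r` is continuous of some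
exponential order and solves the RESOLVENT EQUATION of the renewal kernel `k`, `r(t) = k(t) + ∫₀ᵗ k(t − u) r(u) du` (`t ≥ 0`);
the SYMBOL `E(σ) = 1 − 𝓛k(σ)` (holomorphic on `Re σ > −μ`) satisfies `E ≠ 0` on `{Re σ > −β₀} ∖ {1}`, `E(1) = 0`, `E′(1) ≠ 0`,
with `0 < β < β₀ ≤ μ` — the one-simple-zero case of the weighted Paley–Wiener theorem for resolvents
(Gripenberg–Londen–Staffans 1990, Ch. 7 §2, Thm 2.1; Jordan–Staffans–Wheeler 1982). The citation is PROVENANCE ONLY: every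
statement below is proved here (the book is not held by the tree's library at the time of writing; theorem number from its Ch. 7 §2
«characteristic exponents of the resolvent»).

CONTENT. Step 1: `𝓛r·E = 𝓛k` on `Re σ > max(−μ, a₀)` (Convolution Theorem, `HalfLineExpBound.laplaceC_conv`), hence
`𝓛(r − k) = (𝓛k)²/E`. Step 2: ONE integration by parts (`HalfLineExpBound.norm_laplaceC_le_div_norm`) gives `‖𝓛k(σ)‖ ≤ C₁/‖σ‖`
on `Re σ ≥ −β`, `C₁ = ‖k 0‖ + K/(μ − β)`, hence `‖Φ(σ)‖ ≤ 2C₁²/(Im σ)²` once `|Im σ| ≥ 2C₁ + 1`. Step 3: `Φ` is holomorphic on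
`{Re σ > −β₀} ∖ {1}`, continuous and integrable along every line `Re σ = u ≥ −β` on which `E ≠ 0`
(`integrable_of_continuous_of_sq_tail`: continuous with `O(1/y²)` tails ⇒ integrable).
NOT here: the inversion and the contour shift (Part II), existence of `r`, operators, any model.

## References
* G. Gripenberg, S.-O. Londen, O. Staffans, *Volterra Integral and Functional Equations*, CUP 1990, Ch. 7 Thm 2.1. [GripenbergLondenStaffans1990]
* J. L. Schiff, *The Laplace Transform*, Springer 1999, Thm 1.11, 2.7, 2.39, 3.1, §4.1. [Schiff1999]
-/

noncomputable section

open _root_.Complex _root_.MeasureTheory _root_.Set _root_.Filter _root_.Real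
open scoped _root_.Topology
open Literature.Analysis.Complex

namespace Literature.Analysis.Convolution

/-- **Hypotheses of the resolvent pole theorem.** `k` is `C¹` on `(0,∞)`, continuous on `[0,∞)`, with `‖k‖, ‖k′‖ ≤ K e^{−μt}`;
`r` is continuous of exponential order `a₀` and solves the resolvent equation `r = k + k ⋆ r` on `[0,∞)`; `E` agrees with the
symbol `1 − 𝓛k` on `Re σ > −μ`, does not vanish on `{Re σ > −β₀} ∖ {1}`, and has a simple zero at `σ = 1`; `0 < β < β₀ ≤ μ`.
[cite: GripenbergLondenStaffans1990, Ch. 7 Thm 2.1 (hypotheses, one simple zero)] -/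
structure RenewalPoleData (k k' r : ℝ → ℂ) (E : ℂ → ℂ) (K μ R a₀ β β₀ : ℝ) : Prop where
  hk : HalfLineExpBound k K (-μ)
  hk' : HalfLineExpBound k' K (-μ)
  hasDerivAt : ∀ t : ℝ, 0 < t → HasDerivAt k (k' t) t
  hμ : 0 < μ
  hr : HalfLineExpBound r R a₀
  resolvent_eq : ∀ t : ℝ, 0 ≤ t → r t = k t + ∫ u in (0 : ℝ)..t, k (t - u) * r u
  hE : ∀ s : ℂ, -μ < s.re → E s = 1 - laplaceC k s
  hβ : 0 < β
  hββ₀ : β < β₀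
  hβ₀μ : β₀ ≤ μ
  ne_zero : ∀ s : ℂ, -β₀ < s.re → s ≠ 1 → E s ≠ 0
  E_one : E 1 = 0
  deriv_ne_zero : deriv E 1 ≠ 0

namespace RenewalPoleData

variable {k k' r : ℝ → ℂ} {E : ℂ → ℂ} {K μ R a₀ β β₀ : ℝ}

/-! ### Step 1: the transformed resolvent equation -/

/-- `𝓛k(1) = 1` (the zero of the symbol). [cite: GripenbergLondenStaffans1990, Ch. 7 Thm 2.1 (proof)] -/
theorem laplaceC_k_one (h : RenewalPoleData k k' r E K μ R a₀ β β₀) : laplaceC k 1 = 1 := by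
  have h1 := h.hE 1 (by simp; linarith [h.hμ])
  rw [h.E_one] at h1
  linear_combination h1

/-- The resolvent equation transformed: `𝓛r(σ)·E(σ) = 𝓛k(σ)` on `Re σ > max(−μ, a₀)` (Convolution Theorem).
[cite: Schiff1999, Theorem 2.39 / (2.43)] -/
theorem laplaceC_r_mul_E (h : RenewalPoleData k k' r E K μ R a₀ β β₀) {s : ℂ} (hs : -μ < s.re) (hs' : a₀ < s.re) :
    laplaceC r s * E s = laplaceC k s := by
  -- common exponential order `γ = max (−μ) a₀`
  set γ : ℝ := max (-μ) a₀ with hγ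
  have hγs : γ < s.re := max_lt hs hs'
  have hkγ : HalfLineExpBound k K γ := h.hk.mono (le_max_left _ _)
  have hrγ : HalfLineExpBound r R γ := h.hr.mono (le_max_right _ _)
  have hconv := hkγ.laplaceC_conv hrγ hγs
  have hik := h.hk.integrableOn hs
  have hir := h.hr.integrableOn hs'
  -- the convolution integrand is integrable, being `r − k` on `(0,∞)`
  have hic : IntegrableOn (fun t : ℝ => cexp (-(s * t)) * ∫ u in (0 : ℝ)..t, k (t - u) * r u) (Ioi 0) := by
    refine (hir.sub hik).congr_fun (fun t ht => ?_) measurableSet_Ioi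
    simp only [Pi.sub_apply]
    rw [h.resolvent_eq t (le_of_lt ht)]
    ring
  have hsum : laplaceC r s = laplaceC k s + laplaceC k s * laplaceC r s := by
    rw [← hconv, ← laplaceC_add hik hic]
    exact laplaceC_congr (fun t ht => h.resolvent_eq t (le_of_lt ht)) s
  rw [h.hE s hs]
  linear_combination hsum

/-- `𝓛(r − k) = (𝓛k)²/E` wherever `E ≠ 0` on `Re σ > max(−μ, a₀)`. [cite: GripenbergLondenStaffans1990, Ch. 7 Thm 2.1 (proof)] -/
theorem laplaceC_sub_eq (h : RenewalPoleData k k' r E K μ R a₀ β β₀) {s : ℂ} (hs : -μ < s.re) (hs' : a₀ < s.re)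
    (hE0 : E s ≠ 0) : laplaceC (fun t => r t - k t) s = (laplaceC k s) ^ 2 / E s := by
  have h1 := h.laplaceC_r_mul_E hs hs'
  have h2 := h.hE s hs
  rw [laplaceC_sub (h.hr.integrableOn hs') (h.hk.integrableOn hs), eq_div_iff hE0]
  linear_combination h1 - laplaceC k s * h2

/-! ### Step 2: decay of the symbol and of `Φ = (𝓛k)²/E` on the strip -/

/-- `‖𝓛k(σ)‖ ≤ C₁/‖σ‖` on `Re σ ≥ −β`, `σ ≠ 0`, with `C₁ = ‖k 0‖ + K/(μ − β)`. [cite: Schiff1999, Theorem 2.7 / §4.1 (4.8)] -/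
theorem norm_laplaceC_k_le (h : RenewalPoleData k k' r E K μ R a₀ β β₀) {s : ℂ} (hs : -β ≤ s.re) (hs0 : s ≠ 0) :
    ‖laplaceC k s‖ ≤ (‖k 0‖ + K / (μ - β)) / ‖s‖ :=
  h.hk.norm_laplaceC_le_div_norm h.hk' h.hasDerivAt (by linarith [h.hββ₀, h.hβ₀μ]) hs hs0

/-- The decay constant `C₁ = ‖k 0‖ + K/(μ − β)` is non-negative. [cite: Schiff1999, Theorem 2.7] -/
theorem C₁_nonneg (h : RenewalPoleData k k' r E K μ R a₀ β β₀) : 0 ≤ ‖k 0‖ + K / (μ - β) :=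
  add_nonneg (norm_nonneg _) (div_nonneg h.hk.nonneg (by linarith [h.hββ₀, h.hβ₀μ]))

/-- `‖E(σ)‖ ≥ 1/2` wherever `‖𝓛k(σ)‖ ≤ 1/2` (`Re σ > −μ`). [cite: GripenbergLondenStaffans1990, Ch. 7 Thm 2.1 (proof)] -/
theorem half_le_norm_E (h : RenewalPoleData k k' r E K μ R a₀ β β₀) {s : ℂ} (hs : -μ < s.re)
    (hsmall : ‖laplaceC k s‖ ≤ 1 / 2) : 1 / 2 ≤ ‖E s‖ := by
  rw [h.hE s hs]
  have := norm_sub_norm_le (1 : ℂ) (laplaceC k s)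
  rw [norm_one] at this
  linarith [abs_sub_abs_le_abs_sub ‖(1 : ℂ)‖ ‖laplaceC k s‖]

/-- **Decay on the strip**: for `Re σ ≥ −β` and `|Im σ| ≥ 2C₁ + 1`, `‖(𝓛k)²(σ)/E(σ)‖ ≤ 2C₁²/(Im σ)²`.
[cite: Schiff1999, §4.1 (4.8)–(4.10)] -/
theorem norm_sq_div_le (h : RenewalPoleData k k' r E K μ R a₀ β β₀) {s : ℂ} (hs : -β ≤ s.re)
    (him : 2 * (‖k 0‖ + K / (μ - β)) + 1 ≤ |s.im|) :
    ‖(laplaceC k s) ^ 2 / E s‖ ≤ 2 * (‖k 0‖ + K / (μ - β)) ^ 2 / s.im ^ 2 := by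
  set C₁ : ℝ := ‖k 0‖ + K / (μ - β) with hC₁
  have hC₁0 : 0 ≤ C₁ := h.C₁_nonneg
  have him0 : 0 < |s.im| := by linarith
  have hsn : |s.im| ≤ ‖s‖ := Complex.abs_im_le_norm s
  have hs0 : s ≠ 0 := by
    intro h0; rw [h0] at him0; simp at him0
  have hsμ : -μ < s.re := by linarith [h.hββ₀, h.hβ₀μ]
  have hL : ‖laplaceC k s‖ ≤ C₁ / ‖s‖ := h.norm_laplaceC_k_le hs hs0
  have hL' : ‖laplaceC k s‖ ≤ 1 / 2 := by
    refine hL.trans ?_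
    rw [div_le_iff₀ (norm_pos_iff.2 hs0)]
    nlinarith
  have hE : 1 / 2 ≤ ‖E s‖ := h.half_le_norm_E hsμ hL'
  have hEpos : 0 < ‖E s‖ := by linarith
  have him2 : 0 < s.im ^ 2 := by
    have := pow_pos him0 2
    rwa [sq_abs] at this
  rw [norm_div, norm_pow, div_le_div_iff₀ hEpos him2]
  have h1 : ‖laplaceC k s‖ ^ 2 ≤ (C₁ / ‖s‖) ^ 2 := pow_le_pow_left₀ (norm_nonneg _) hL 2
  have h2 : (C₁ / ‖s‖) ^ 2 ≤ C₁ ^ 2 / s.im ^ 2 := by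
    rw [div_pow, ← sq_abs s.im]
    exact div_le_div_of_nonneg_left (sq_nonneg _) (by positivity) (pow_le_pow_left₀ him0.le hsn 2)
  calc ‖laplaceC k s‖ ^ 2 * s.im ^ 2 ≤ C₁ ^ 2 / s.im ^ 2 * s.im ^ 2 := by
        exact mul_le_mul_of_nonneg_right (h1.trans h2) (sq_nonneg _)
    _ = C₁ ^ 2 := div_mul_cancel₀ _ (ne_of_gt him2)
    _ ≤ 2 * C₁ ^ 2 * ‖E s‖ := by nlinarith [sq_nonneg C₁]

/-! ### Step 3: holomorphy, continuity and integrability of `Φ` on the lines -/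

/-- `E` is holomorphic on `Re σ > −μ`. [cite: Schiff1999, Theorem 3.1] -/
theorem differentiableOn_E (h : RenewalPoleData k k' r E K μ R a₀ β β₀) :
    DifferentiableOn ℂ E {s : ℂ | -μ < s.re} :=
  ((differentiableOn_const (1 : ℂ)).sub h.hk.differentiableOn_laplaceC).congr fun s hs => h.hE s hs

/-- `Φ = (𝓛k)²/E` is holomorphic on `{Re σ > −β₀} ∖ {1}`. [cite: GripenbergLondenStaffans1990, Ch. 7 Thm 2.1 (proof)] -/
theorem differentiableOn_sq_div (h : RenewalPoleData k k' r E K μ R a₀ β β₀) :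
    DifferentiableOn ℂ (fun s => (laplaceC k s) ^ 2 / E s) ({s : ℂ | -β₀ < s.re} \ ({1} : Finset ℂ)) := by
  have hsub : {s : ℂ | -β₀ < s.re} \ (({1} : Finset ℂ) : Set ℂ) ⊆ {s : ℂ | -μ < s.re} := fun s hs => by
    have : -β₀ < s.re := hs.1
    show -μ < s.re
    linarith [h.hβ₀μ]
  refine ((h.hk.differentiableOn_laplaceC.mono hsub).pow 2).div (h.differentiableOn_E.mono hsub) fun s hs => ?_
  exact h.ne_zero s hs.1 (by simpa using hs.2)

/-- Along a vertical line `Re σ = u` with `u > −μ` on which `E ≠ 0`, `y ↦ Φ(u + iy)` is continuous.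
[cite: Schiff1999, Theorem 3.1] -/
theorem continuous_sq_div_vertical (h : RenewalPoleData k k' r E K μ R a₀ β β₀) {u : ℝ} (hu : -μ < u)
    (hE0 : ∀ y : ℝ, E (u + y * I) ≠ 0) :
    Continuous fun y : ℝ => (laplaceC k (u + y * I)) ^ 2 / E (u + y * I) := by
  have hc := h.hk.continuous_laplaceC_vertical hu
  have hE : Continuous fun y : ℝ => E (u + y * I) := by
    have : (fun y : ℝ => E (u + y * I)) = fun y : ℝ => 1 - laplaceC k (u + y * I) := by
      ext y; exact h.hE _ (by simpa using hu)
    rw [this]; exact continuous_const.sub hc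
  exact (hc.pow 2).div hE hE0

/-- A continuous function on `ℝ` with `O(1/y²)` tails is integrable. [cite: Schiff1999, §4.1 (4.8) (absolute convergence of the
Bromwich integral)] -/
theorem integrable_of_continuous_of_sq_tail {φ : ℝ → ℂ} (hφ : Continuous φ) {C T : ℝ} (hT : 0 < T)
    (hb : ∀ y : ℝ, T ≤ |y| → ‖φ y‖ ≤ C / y ^ 2) : Integrable φ := by
  obtain ⟨M, hM⟩ := (isCompact_Icc (a := -T) (b := T)).exists_bound_of_continuousOn hφ.continuousOn
  have hM0 : 0 ≤ M := (norm_nonneg _).trans (hM 0 ⟨by linarith, by linarith⟩)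
  have hC0 : 0 ≤ C := by
    have h2 : 0 ≤ C / T ^ 2 := (norm_nonneg _).trans (hb T (by rw [abs_of_pos hT]))
    rwa [le_div_iff₀ (by positivity), zero_mul] at h2
  set B : ℝ := M * (1 + T ^ 2) + C * (1 + 1 / T ^ 2) with hB
  refine Integrable.mono' (integrable_inv_one_add_sq.const_mul B) hφ.aestronglyMeasurable (Eventually.of_forall fun y => ?_)
  have h1y : 0 < 1 + y ^ 2 := by positivity
  rw [← div_eq_mul_inv, le_div_iff₀ h1y]
  by_cases hy : |y| ≤ T
  · have hyI : y ∈ Icc (-T) T := ⟨by linarith [neg_abs_le y], le_trans (le_abs_self y) hy⟩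
    have hy2 : y ^ 2 ≤ T ^ 2 := by rw [← sq_abs]; exact pow_le_pow_left₀ (abs_nonneg _) hy 2
    calc ‖φ y‖ * (1 + y ^ 2) ≤ M * (1 + T ^ 2) := by
          exact mul_le_mul (hM y hyI) (by linarith) h1y.le hM0
      _ ≤ B := by
          have : 0 ≤ C * (1 + 1 / T ^ 2) := by positivity
          rw [hB]; linarith
  · rw [not_le] at hy
    have hyne : y ≠ 0 := by
      intro h0; rw [h0, abs_zero] at hy; linarith
    have hTy : T ^ 2 ≤ y ^ 2 := by rw [← sq_abs y]; exact pow_le_pow_left₀ hT.le hy.le 2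
    have hb' := hb y hy.le
    calc ‖φ y‖ * (1 + y ^ 2) ≤ C / y ^ 2 * (1 + y ^ 2) := mul_le_mul_of_nonneg_right hb' h1y.le
      _ = C * (1 + 1 / y ^ 2) := by field_simp; ring
      _ ≤ C * (1 + 1 / T ^ 2) := by
          apply mul_le_mul_of_nonneg_left _ hC0
          have := one_div_le_one_div_of_le (by positivity) hTy
          linarith
      _ ≤ B := by
          have : 0 ≤ M * (1 + T ^ 2) := by positivity
          rw [hB]; linarith

/-- Integrability of `Φ` along a line `Re σ = u`, `−β ≤ u`, on which `E ≠ 0`. [cite: Schiff1999, §4.1 (4.8)] -/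
theorem integrable_sq_div_vertical (h : RenewalPoleData k k' r E K μ R a₀ β β₀) {u : ℝ} (hu : -β ≤ u)
    (hE0 : ∀ y : ℝ, E (u + y * I) ≠ 0) :
    Integrable fun y : ℝ => (laplaceC k (u + y * I)) ^ 2 / E (u + y * I) := by
  have huμ : -μ < u := by linarith [h.hββ₀, h.hβ₀μ]
  refine integrable_of_continuous_of_sq_tail (h.continuous_sq_div_vertical huμ hE0)
    (C := 2 * (‖k 0‖ + K / (μ - β)) ^ 2) (T := 2 * (‖k 0‖ + K / (μ - β)) + 1) (by linarith [h.C₁_nonneg]) fun y hy => ?_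
  have := h.norm_sq_div_le (s := u + y * I) (by simpa using hu) (by simpa using hy)
  simpa using this


end RenewalPoleData

end Literature.Analysis.Convolution
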